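import Literature.MathematicalPhysics.QuantumFieldTheory.Balaban1983to89.BlockAveragingEMLLinearisedBackground
import HarnessLib

/-!
# Route `UnitScaleTilt`, crux K1 child «MinimiserStabilityRegPr» (stmt-QuantumFields-19200), leaf V3 `stub_prop7From14`, sub-lemma V3-D1c:
# THE LINEARISED (0.4)-AVERAGE AT A SMALL-PLAQUETTE BACKGROUND — the hypotheses of `BlockAveragingEMLLinearisedBackground` read from
# `PlaqSmall`, the carrier vocabulary of the route's coercivity files (`Prop7Covariant*`)

Fleet seat `ym-ust-19200-p2` (gen 2), `--supports stmt-QuantumFields-19200`.  Bookkeeping only: the Literature module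
`BlockAveragingEMLLinearisedBackground` ([Balaban1985Averaging] Prop. 3 (122)–(125) at a small-field background for the (0.4) averaging of record)
asks that every (0.4) loop variable of the background at the coarse bond `c` be within `α` of `1`; the route's files carry the background through
its PLAQUETTE variables (`PlaqSmall a U₀`, `a = εL^{-2(K−n)}`).  The tree's exact lattice Stokes bound `LatticeWordStokes.dist1_loopHol_le` converts
one into the other with `α = (((d+2)L)²/4)·a`, so the linearisation estimate holds in the form the assembly consumes:
`‖Ū(c)Ū₀(c)* − 1 − (Q₁^{R₀}(U₀)Y)(c)‖ ≤ 404·ℓδ·(ℓδ + (ℓ²/4)·a)` for `Y = UU₀⁻¹ − 1` bondwise `δ`-small, `48ℓδ ≤ 1`, `(ℓ²/4)a ≤ 1/24`,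
`2ℓδ + (ℓ²/4)a < δ_N` (`ℓ = (d+2)L`).  Nothing of Bałaban's is asserted; no stub is closed; helper toward V3's real-fibre assembly.

References: T. Bałaban, CMP 98 (1985) 17–51 [Balaban1985Averaging] (Prop. 3 p.36); CMP 109 (1987) 249–301 [Balaban1987RG1] ((0.4) p.253).
-/

noncomputable section

namespace Summit.QuantumFields.YangMills.Theorems.Prop7AvgLinearisation

open Literature.MathematicalPhysics.QuantumFieldTheory.Balaban1983to89
open T4Continuum BlockAveraging AveragingRT ExpMeanLog LatticeWordStokes BlockAveragingEMLLinearisedBackground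
open scoped Matrix.Norms.L2Operator

variable {n : Type*} [Fintype n] [DecidableEq n] [Nonempty n] {P : Params} {j : ℕ}

/-- **THE LINEARISED (0.4) AVERAGE AT A SMALL-PLAQUETTE BACKGROUND, `R₀` FORM**: if every plaquette variable of the background `U₀` is within `a`
of `1` (`PlaqSmall a U₀`), the perturbation `Y_b = U_bU₀,b⁻¹ − 1` satisfies `‖Y_b‖ ≤ δ`, and with `ℓ = (d+2)L`, `α := (ℓ²/4)·a`: `48ℓδ ≤ 1`,
`α ≤ 1/24`, `2ℓδ + α < δ_N`, then for every coarse bond `c`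
`‖Ū(c)·Ū₀(c)* − 1 − (Q₁^{R₀}(U₀)Y)(c)‖ ≤ 404·ℓδ·(ℓδ + α)` (`Ū = avgFun expMeanLogSU U`; `Q₁^{R₀}(U₀) = covLinAvgR0 U₀`: covariant comb sum at
`c₋` + comb-transported covariant straight-line sum − loop-transported covariant comb sum at `c₊`).  The loop variables of `U₀` are within `α` of
`1` by the exact lattice Stokes bound `LatticeWordStokes.dist1_loopHol_le`. [cite: Balaban1985Averaging, Prop. 3 (122)-(125) p.36] -/
theorem norm_avgFun_ratio_sub_one_sub_covLinAvgR0_le_of_plaqSmall (U₀ U : GaugeField P j (Matrix.specialUnitaryGroup n ℂ)) {δ a : ℝ}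
    (hδ : 0 ≤ δ) (ha : 0 ≤ a) (hU₀ : PlaqSmall a U₀) (hY : ∀ b, ‖pertVar U₀ U b‖ ≤ δ)
    (h48 : 48 * ((((P.d + 2) * P.L : ℕ) : ℝ) * δ) ≤ 1)
    (hα24 : ((((P.d + 2) * P.L : ℕ) : ℝ) ^ 2 / 4) * a ≤ 1 / 24)
    (hN : 2 * ((((P.d + 2) * P.L : ℕ) : ℝ) * δ) + ((((P.d + 2) * P.L : ℕ) : ℝ) ^ 2 / 4) * a < deltaSU n) (c : PBond P (j + 1)) :
    ‖((avgFun (expMeanLogSU (n := n)) U c : Matrix.specialUnitaryGroup n ℂ) : Matrix n n ℂ) *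
          star ((avgFun (expMeanLogSU (n := n)) U₀ c : Matrix.specialUnitaryGroup n ℂ) : Matrix n n ℂ) - 1 -
        covLinAvgR0 U₀ (pertVar U₀ U) c‖ ≤
      404 * ((((P.d + 2) * P.L : ℕ) : ℝ) * δ) * ((((P.d + 2) * P.L : ℕ) : ℝ) * δ + ((((P.d + 2) * P.L : ℕ) : ℝ) ^ 2 / 4) * a) :=
  norm_avgFun_ratio_sub_one_sub_covLinAvgR0_le U₀ U hδ hY h48 c (fun i => dist1_loopHol_le ha hU₀ c i) hα24 hN

/-- The same in the raw form `covLinAvg` (mean of the covariant loop sums plus the covariant straight sum), constant `400`.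
[cite: Balaban1985Averaging, Prop. 3 (122)-(124) p.36] -/
theorem norm_avgFun_ratio_sub_one_sub_covLinAvg_le_of_plaqSmall (U₀ U : GaugeField P j (Matrix.specialUnitaryGroup n ℂ)) {δ a : ℝ}
    (hδ : 0 ≤ δ) (ha : 0 ≤ a) (hU₀ : PlaqSmall a U₀) (hY : ∀ b, ‖pertVar U₀ U b‖ ≤ δ)
    (h48 : 48 * ((((P.d + 2) * P.L : ℕ) : ℝ) * δ) ≤ 1)
    (hα24 : ((((P.d + 2) * P.L : ℕ) : ℝ) ^ 2 / 4) * a ≤ 1 / 24)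
    (hN : 2 * ((((P.d + 2) * P.L : ℕ) : ℝ) * δ) + ((((P.d + 2) * P.L : ℕ) : ℝ) ^ 2 / 4) * a < deltaSU n) (c : PBond P (j + 1)) :
    ‖((avgFun (expMeanLogSU (n := n)) U c : Matrix.specialUnitaryGroup n ℂ) : Matrix n n ℂ) *
          star ((avgFun (expMeanLogSU (n := n)) U₀ c : Matrix.specialUnitaryGroup n ℂ) : Matrix n n ℂ) - 1 -
        covLinAvg U₀ (pertVar U₀ U) c‖ ≤
      400 * ((((P.d + 2) * P.L : ℕ) : ℝ) * δ) * ((((P.d + 2) * P.L : ℕ) : ℝ) * δ + ((((P.d + 2) * P.L : ℕ) : ℝ) ^ 2 / 4) * a) :=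
  norm_avgFun_ratio_sub_one_sub_covLinAvg_le U₀ U hδ hY h48 c (fun i => dist1_loopHol_le ha hU₀ c i) hα24 hN

/-- **FLAT DATUM AS BACKGROUND** (`U₀ = 1`): the perturbation variable is `U_b − 1` and the covariant linear term is the flat `linAvg` of
`BlockAveragingEMLLinearised` rearranged — the loop sums are plain signed sums (`covWalkSum_one`). Consistency check between the two modules at the
level of the linear functionals. [cite: Balaban1985Averaging, (124)-(125) p.36] -/
theorem covLinAvg_one (Y : PBond P j → Matrix n n ℂ) (c : PBond P (j + 1)) :
    covLinAvg (1 : GaugeField P j (Matrix.specialUnitaryGroup n ℂ)) Y c =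
      ((Fintype.card (Idx P) : ℂ))⁻¹ • ∑ i : Idx P,
          BlockAveragingEMLLinearised.walkSum Y (walk (emb c.src) (loopWord P.L c.dir (off i.1) i.2.1 i.2.2)) +
        BlockAveragingEMLLinearised.walkSum Y (walk (emb c.src) (List.replicate P.L (c.dir, true))) := by
  rw [covLinAvg_def]
  simp only [covWalkSum_one]

/-! ## v1.1 (append-only): on the fibre through the background, the linearised constraint holds to second order -/

/-- **ON THE FIBRE THROUGH `U₀` THE LINEARISED (0.4)-CONSTRAINT HOLDS TO SECOND ORDER** (the form [Balaban1985Variational] Sect. C (43)–(48) consumes: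
the nonlinear constraint `Ū = Ū₀` at the coarse bond `c` forces `(Q₁^{R₀}(U₀)Y)(c) = O(ℓδ·(ℓδ + α))`): if `avgFun expMeanLogSU U c = avgFun expMeanLogSU U₀ c`
then `‖(Q₁^{R₀}(U₀)Y)(c)‖ ≤ 404·ℓδ·(ℓδ + (ℓ²/4)a)` under the hypotheses of `norm_avgFun_ratio_sub_one_sub_covLinAvgR0_le_of_plaqSmall`.
[cite: Balaban1985Averaging, Prop. 3 (122)-(125) p.36] -/
theorem norm_covLinAvgR0_le_of_avgFun_eq (U₀ U : GaugeField P j (Matrix.specialUnitaryGroup n ℂ)) {δ a : ℝ}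
    (hδ : 0 ≤ δ) (ha : 0 ≤ a) (hU₀ : PlaqSmall a U₀) (hY : ∀ b, ‖pertVar U₀ U b‖ ≤ δ)
    (h48 : 48 * ((((P.d + 2) * P.L : ℕ) : ℝ) * δ) ≤ 1)
    (hα24 : ((((P.d + 2) * P.L : ℕ) : ℝ) ^ 2 / 4) * a ≤ 1 / 24)
    (hN : 2 * ((((P.d + 2) * P.L : ℕ) : ℝ) * δ) + ((((P.d + 2) * P.L : ℕ) : ℝ) ^ 2 / 4) * a < deltaSU n) (c : PBond P (j + 1))
    (hfib : avgFun (expMeanLogSU (n := n)) U c = avgFun (expMeanLogSU (n := n)) U₀ c) :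
    ‖covLinAvgR0 U₀ (pertVar U₀ U) c‖ ≤
      404 * ((((P.d + 2) * P.L : ℕ) : ℝ) * δ) * ((((P.d + 2) * P.L : ℕ) : ℝ) * δ + ((((P.d + 2) * P.L : ℕ) : ℝ) ^ 2 / 4) * a) := by
  have h := norm_avgFun_ratio_sub_one_sub_covLinAvgR0_le_of_plaqSmall U₀ U hδ ha hU₀ hY h48 hα24 hN c
  have hu : ((avgFun (expMeanLogSU (n := n)) U₀ c : Matrix.specialUnitaryGroup n ℂ) : Matrix n n ℂ) *
      star ((avgFun (expMeanLogSU (n := n)) U₀ c : Matrix.specialUnitaryGroup n ℂ) : Matrix n n ℂ) = 1 :=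
    Unitary.mul_star_self_of_mem (Matrix.mem_specialUnitaryGroup_iff.1 (avgFun (expMeanLogSU (n := n)) U₀ c).2).1
  rw [hfib, hu, sub_self, zero_sub, norm_neg] at h
  exact h

/-- The same in the raw form `covLinAvg` (constant `400`). [cite: Balaban1985Averaging, Prop. 3 (122)-(124) p.36] -/
theorem norm_covLinAvg_le_of_avgFun_eq (U₀ U : GaugeField P j (Matrix.specialUnitaryGroup n ℂ)) {δ a : ℝ}
    (hδ : 0 ≤ δ) (ha : 0 ≤ a) (hU₀ : PlaqSmall a U₀) (hY : ∀ b, ‖pertVar U₀ U b‖ ≤ δ)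
    (h48 : 48 * ((((P.d + 2) * P.L : ℕ) : ℝ) * δ) ≤ 1)
    (hα24 : ((((P.d + 2) * P.L : ℕ) : ℝ) ^ 2 / 4) * a ≤ 1 / 24)
    (hN : 2 * ((((P.d + 2) * P.L : ℕ) : ℝ) * δ) + ((((P.d + 2) * P.L : ℕ) : ℝ) ^ 2 / 4) * a < deltaSU n) (c : PBond P (j + 1))
    (hfib : avgFun (expMeanLogSU (n := n)) U c = avgFun (expMeanLogSU (n := n)) U₀ c) :
    ‖covLinAvg U₀ (pertVar U₀ U) c‖ ≤
      400 * ((((P.d + 2) * P.L : ℕ) : ℝ) * δ) * ((((P.d + 2) * P.L : ℕ) : ℝ) * δ + ((((P.d + 2) * P.L : ℕ) : ℝ) ^ 2 / 4) * a) := by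
  have h := norm_avgFun_ratio_sub_one_sub_covLinAvg_le_of_plaqSmall U₀ U hδ ha hU₀ hY h48 hα24 hN c
  have hu : ((avgFun (expMeanLogSU (n := n)) U₀ c : Matrix.specialUnitaryGroup n ℂ) : Matrix n n ℂ) *
      star ((avgFun (expMeanLogSU (n := n)) U₀ c : Matrix.specialUnitaryGroup n ℂ) : Matrix n n ℂ) = 1 :=
    Unitary.mul_star_self_of_mem (Matrix.mem_specialUnitaryGroup_iff.1 (avgFun (expMeanLogSU (n := n)) U₀ c).2).1
  rw [hfib, hu, sub_self, zero_sub, norm_neg] at h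
  exact h

/-- **FLAT DATUM**: if the (0.4) average of `U` at `c` is trivial (`U` in the fibre of the flat datum at `c`) and `‖U_b − 1‖ ≤ δ` with `16ℓδ ≤ 1`,
`2ℓδ < δ_N`, then the flat linearised constraint holds to second order: `‖(Q₁(U − 1))(c)‖ ≤ 81(ℓδ)²`. [cite: Balaban1985Averaging, Prop. 3 (122)-(123) p.36] -/
theorem norm_linAvg_le_of_avgFun_eq_one (U : GaugeField P j (Matrix.specialUnitaryGroup n ℂ)) {δ : ℝ} (hδ : 0 ≤ δ)
    (hU : ∀ b, ‖((U b : Matrix.specialUnitaryGroup n ℂ) : Matrix n n ℂ) - 1‖ ≤ δ)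
    (h16 : 16 * ((((P.d + 2) * P.L : ℕ) : ℝ) * δ) ≤ 1) (hN : 2 * ((((P.d + 2) * P.L : ℕ) : ℝ) * δ) < deltaSU n) (c : PBond P (j + 1))
    (hfib : avgFun (expMeanLogSU (n := n)) U c = 1) :
    ‖BlockAveragingEMLLinearised.linAvg (fun b => ((U b : Matrix.specialUnitaryGroup n ℂ) : Matrix n n ℂ) - 1) c‖ ≤
      81 * ((((P.d + 2) * P.L : ℕ) : ℝ) * δ) ^ 2 := by
  have h := BlockAveragingEMLLinearised.norm_avgFun_sub_one_sub_linAvg_le U hδ hU h16 hN c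
  rw [hfib, OneMemClass.coe_one, sub_self, zero_sub, norm_neg] at h
  exact h

end Summit.QuantumFields.YangMills.Theorems.Prop7AvgLinearisation

end
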